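import Literature.AlgebraicGeometry.Motives.HodgeStructureLefschetzGroupCenter
import Literature.AlgebraicGeometry.Motives.HodgeStructurePolarizationAutGroup
import HarnessLib

/-!
# THE CENTRES OF THE HODGE AND MUMFORD–TATE GROUPS ARE THEIR HODGE-ENDOMORPHISM PARTS: `Z(Hg(H)(ℚ)) = Hg(H)(ℚ) ∩ E_φ^×`,
# `Z(MT(H)(ℚ)) = MT(H)(ℚ) ∩ E_φ^×` (equality, upgrading the tree's `⊇`), the same on `K`-points with `E_φ ⊗ K`, and
# `Z(Hg(H)(ℚ)) ⊆ Z(S(H)(ℚ))` — via `ℚ[Hg(H)] = C(H)` and Remark 1.2 `C(H)' = E_φ` (Milne 1999 §1 Rem. 1.2, §4 p. 660; GGK (V.2))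

[topic AlgebraicGeometry/Motives]

Layer `Literature/AlgebraicGeometry/Motives`, lane `lit-hodgefound` (Track 2 foundations library; prover seat
`lit-hodgefound-p02`, generation 54, self-proposed row g54-#7). THEOREMS ONLY: no definition, no named fact (net debt `0`),
no instance, no notation.  The Mumford–Tate side of g54-#4 (`Motives/HodgeStructureLefschetzGroupCenter`: the centre of Milne's
`S(A)` is `S(A) ∩ C₀`).  GGK prove «any Mumford–Tate group commutes with `End(V, φ)`», so `Hg(H)(ℚ) ∩ Aut(V, φ)` is central in
`Hg(H)(ℚ)` (the tree's `autGroup_subgroupOf_hodgeGroup_le_center`, `Motives/HodgeStructureAutGroupHodgeLefschetzGroups`).  The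
CONVERSE holds for polarizable `H`: an element of `Hg(H)(ℚ)` central in `Hg(H)(ℚ)` commutes with the algebra `ℚ[Hg(H)(ℚ)]`, which
is Milne's centralizer `C(H)` (the tree's `adjoin_hodgeGroup_eq_centralizer_endAlg`, Deligne's «`E` is the commutant of `G`»),
hence lies in `Z_{End_ℚ(V)}(C(H)) = E_φ` (Remark 1.2 by the printed route, g54-#1 `centralizer_centralizer_endAlg_eq'`).  So
`Z(Hg(H)(ℚ)) = Hg(H)(ℚ) ∩ Aut(V, φ)`, and likewise for `MT(H)(ℚ) ⊇ Hg(H)(ℚ)`; the central elements are central Hodge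
endomorphisms (`∈ Z(E_φ) = C₀`), so `Z(Hg(H)(ℚ)) ⊆ Z(MT(H)(ℚ))` and — `Hg(H)(ℚ) ≤ S(H)(ℚ)` («`L(A) ⊃ Hg(A)`», the tree's
`hodgeGroup_le_lefschetzGroup`) — `Z(Hg(H)(ℚ)) ⊆ Z(S(H)(ℚ))` (g54-#4).  On `K`-points: `Z(Hg(H)(K)) = Hg(H)(K) ∩ (E_φ ⊗ K)` and the
same for `MT(H)(K)` (`K[Hg(H)(K)] = C(H)(K)`, the tree's `adjoin_coe_hodgeGroupBaseChange_eq_centralizer_endAlg_baseChange`, and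
`Z_K(C(H)(K)) = E_φ ⊗ K`, g54-#2).  The standing instance hypothesis `[HodgeTensorFacts]` is the one through which the tree DEFINES
`Hg` and `MT` (tensor spaces of Hodge structures); it is the tree's theorem `hodgeTensorFacts_holds`.

## The sources, verbatim

* J. S. Milne, *Lefschetz classes on abelian varieties*, Duke Math. J. 96 (1999) 639–675 [Milne1999LefschetzClasses] (held
  `paper:doi-10-1215-s0012-7094-99-09620-5`): §1 Remark 1.2 (p. 643) "the centralizer of `C(A)` in `End_k(V(A))` is
  `End⁰(A) ⊗_ℚ k`"; §4 p. 660 L27–L35 "The Hodge group `Hg(A)` of `A` is defined to be the largest algebraic subgroup of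
  `GL(V_B(A)) × 𝔾_m` fixing all the Hodge classes on `A` and its powers. […] Clearly `D_hom(A) ⊂ H(A)`, and so `L(A) ⊃ Hg(A)`.";
  §3 p. 653 L42–L44 "the `k`-algebra `C(A)` is generated by the `γ ∈ S(A)(k)`".
* M. Green, P. Griffiths, M. Kerr, *Mumford–Tate Groups and Domains* (2012) [GreenGriffithsKerr2012], Prop. (V.2) and its proof
  (p. 152: «any Mumford–Tate group commutes with `End(V, φ)`», `E^* ⊂ G̃(ℚ)`), §V.B (i)–(ii) (p. 158).
* P. Deligne, *Hodge cycles on abelian varieties*, LNM 900 (1982) [Deligne1982HodgeCycles], I §3 Prop. 3.4 and §5 proof of Prop. 5.1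
  («`E` is the commutant of `G` in `End(H₁(A, ℚ))`»).

## Dictionary and what is proved (namespace `Literature.AlgebraicGeometry.Motives.HodgeStructure`)

`Hg(H)(ℚ) = H.hodgeGroup`, `MT(H)(ℚ) = H.mumfordTateGroup ≤ GL(V)`, `Aut(V, φ) = H.autGroup = {g | ↑g ∈ E_φ}`,
`Hg(H)(K) = H.hodgeGroupBaseChange K`, `MT(H)(K) = H.mumfordTateGroupBaseChange K`, `S(H)(ℚ) = ψ.lefschetzGroup`,
`E_φ ⊗ K = Algebra.adjoin K {a_K}`; `H` polarizable, `V` finite-dimensional, `[HodgeTensorFacts]`.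

* §1 `ℚ`-points: **`mem_center_hodgeGroup_iff`** (`γ ∈ Hg(H)(ℚ)` central iff `↑γ ∈ E_φ`), **`center_hodgeGroup_eq_autGroup_subgroupOf`**
  (`Z(Hg(H)(ℚ)) = Hg(H)(ℚ) ⊓ Aut(V, φ)`, equality), `mem_center_hodgeGroup_iff_exists_mem_center` (central elements are central
  Hodge endomorphisms), **`mem_center_mumfordTateGroup_iff`**, **`center_mumfordTateGroup_eq_autGroup_subgroupOf`**,
  `inclusion_mem_center_mumfordTateGroup` (`Z(Hg(H)(ℚ)) ⊆ Z(MT(H)(ℚ))`),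
  **`Polarization.inclusion_mem_center_lefschetzGroup`** (`Z(Hg(H)(ℚ)) ⊆ Z(S(H)(ℚ))`).
* §2 `K`-points: **`mem_center_hodgeGroupBaseChange_iff`** (`γ ∈ Hg(H)(K)` central iff `↑γ ∈ E_φ ⊗ K`),
  **`mem_center_mumfordTateGroupBaseChange_iff`**.
-/

noncomputable section

open scoped TensorProduct

namespace Literature.AlgebraicGeometry.Motives

namespace HodgeStructure

universe u uK

variable {V : Type u} [AddCommGroup V] [Module ℚ V] [Module.Finite ℚ V] [HodgeTensorFacts.{u, u}] {n : ℤ}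
  (H : HodgeStructure V n)

omit [Module.Finite ℚ V] [HodgeTensorFacts.{u, u}] in
/-- The commutant of a set is the commutant of the algebra it generates. [folklore] -/
private theorem centralizer_coe_adjoin_eq₅₄'' {R : Type*} {A : Type*} [CommSemiring R] [Semiring A] [Algebra R A]
    (s : Set A) : Subalgebra.centralizer R (Algebra.adjoin R s : Set A) = Subalgebra.centralizer R s := by
  refine le_antisymm (fun z hz => ?_) (fun z hz => ?_)
  · rw [Subalgebra.mem_centralizer_iff] at hz ⊢
    exact fun g hg => hz g (Algebra.subset_adjoin hg)
  · rw [Subalgebra.mem_centralizer_iff] at hz ⊢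
    intro g hg
    have hle : Algebra.adjoin R s ≤ Subalgebra.centralizer R {z} := Algebra.adjoin_le fun x hx => by
      rw [SetLike.mem_coe, Subalgebra.mem_centralizer_iff]
      intro y hy
      rw [Set.mem_singleton_iff.1 hy]
      exact (hz x hx).symm
    exact ((Subalgebra.mem_centralizer_iff R).1 (hle hg) z rfl).symm

/-! ## §1 `ℚ`-points: `Z(Hg(H)(ℚ)) = Hg(H)(ℚ) ∩ Aut(V, φ)`, `Z(MT(H)(ℚ)) = MT(H)(ℚ) ∩ Aut(V, φ)` -/

/-- **AN ELEMENT OF THE HODGE GROUP IS CENTRAL IFF IT IS A HODGE ENDOMORPHISM** (polarizable `H`): `γ ∈ Hg(H)(ℚ)` commutes with all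
of `Hg(H)(ℚ)` iff `↑γ ∈ E_φ` — `⟹`: `γ` commutes with `ℚ[Hg(H)(ℚ)] = C(H)` (the tree's `adjoin_hodgeGroup_eq_centralizer_endAlg`), so
`↑γ ∈ Z_{End_ℚ(V)}(C(H)) = E_φ` (Remark 1.2, g54-#1); `⟸`: `Hg(H)(ℚ) ⊆ C(H)` commutes with `E_φ` (the tree's
`hodgeGroup_mem_centralizer_endAlg`, «any Mumford–Tate group commutes with `End(V, φ)`»).
[cite: GreenGriffithsKerr2012, Prop. (V.2) and proof (p. 152)] [cite: Milne1999LefschetzClasses, §1 Remark 1.2 (p. 643) and §4 p. 660 L27–L35]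
[cite: Deligne1982HodgeCycles, I §5 proof of Prop. 5.1] -/
theorem mem_center_hodgeGroup_iff (hH : H.IsPolarizable) (γ : H.hodgeGroup) :
    γ ∈ Subgroup.center H.hodgeGroup ↔ ((γ : V ≃ₗ[ℚ] V) : Module.End ℚ V) ∈ H.endAlg := by
  rw [Subgroup.mem_center_iff, ← centralizer_centralizer_endAlg_eq' H hH, ← adjoin_hodgeGroup_eq_centralizer_endAlg H hH,
    centralizer_coe_adjoin_eq₅₄'', Subalgebra.mem_centralizer_iff]
  constructor
  · rintro h _ ⟨g, hg, rfl⟩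
    have hgγ := congrArg (fun ε : H.hodgeGroup => ((ε : V ≃ₗ[ℚ] V) : Module.End ℚ V)) (h ⟨g, hg⟩)
    simpa only [Subgroup.coe_mul, LinearEquiv.coe_toLinearMap_mul] using hgγ
  · intro h δ
    refine Subtype.ext (LinearEquiv.toLinearMap_injective ?_)
    rw [Subgroup.coe_mul, Subgroup.coe_mul, LinearEquiv.coe_toLinearMap_mul, LinearEquiv.coe_toLinearMap_mul]
    exact h _ ⟨δ, δ.2, rfl⟩

/-- **`Z(Hg(H)(ℚ)) = Hg(H)(ℚ) ⊓ Aut(V, φ)`** — EQUALITY (the tree's `autGroup_subgroupOf_hodgeGroup_le_center` is `⊇`): the centre of the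
Hodge group of a polarizable `ℚ`-Hodge structure is its intersection with the automorphism group `Aut(V, φ) = E_φ^×` of the Hodge
structure. [cite: GreenGriffithsKerr2012, Prop. (V.2) and proof (p. 152), §V.B (i)–(ii)] [cite: Milne1999LefschetzClasses, §1 Remark 1.2 (p. 643)] -/
theorem center_hodgeGroup_eq_autGroup_subgroupOf (hH : H.IsPolarizable) :
    Subgroup.center H.hodgeGroup = H.autGroup.subgroupOf H.hodgeGroup := by
  ext γ
  rw [mem_center_hodgeGroup_iff H hH, Subgroup.mem_subgroupOf, mem_autGroup_iff]

/-- **Central elements of `Hg(H)(ℚ)` are CENTRAL Hodge endomorphisms**: `γ` is central iff `↑γ = ↑z` for some `z ∈ Z(E_φ) = C₀`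
(`Hg(H)(ℚ) ⊆ C(H)` and `E_φ ∩ C(H) = Z(E_φ)`). [cite: GreenGriffithsKerr2012, Prop. (V.2) and proof (p. 152)]
[cite: Milne1999LefschetzClasses, §1 Remark 1.2 (p. 643) and p. 645 L1–L6] -/
theorem mem_center_hodgeGroup_iff_exists_mem_center (hH : H.IsPolarizable) (γ : H.hodgeGroup) :
    γ ∈ Subgroup.center H.hodgeGroup ↔
      ∃ z : H.endAlg, z ∈ Subalgebra.center ℚ H.endAlg ∧ (z : Module.End ℚ V) = ((γ : V ≃ₗ[ℚ] V) : Module.End ℚ V) := by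
  rw [mem_center_hodgeGroup_iff H hH]
  have hγC : ((γ : V ≃ₗ[ℚ] V) : Module.End ℚ V) ∈ Subalgebra.centralizer ℚ (H.endAlg : Set (Module.End ℚ V)) :=
    hodgeGroup_mem_centralizer_endAlg H γ.2
  constructor
  · intro h
    exact ⟨⟨_, h⟩, (mem_center_endAlg_iff_coe_mem_centralizer_endAlg H _).2 hγC, rfl⟩
  · rintro ⟨z, -, hz⟩
    rw [← hz]
    exact z.2

/-- **AN ELEMENT OF THE MUMFORD–TATE GROUP IS CENTRAL IFF IT IS A HODGE ENDOMORPHISM** (polarizable `H`): `⟹` through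
`Hg(H)(ℚ) ≤ MT(H)(ℚ)` as for the Hodge group; `⟸`: `MT(H)(ℚ) ⊆ C(H)` (the tree's `mumfordTateGroup_mem_centralizer_endAlg`).
[cite: GreenGriffithsKerr2012, Prop. (V.2) and proof (p. 152)] [cite: Milne1999LefschetzClasses, §1 Remark 1.2 (p. 643)]
[cite: Deligne1982HodgeCycles, I §3 Prop. 3.4 and §5 proof of Prop. 5.1] -/
theorem mem_center_mumfordTateGroup_iff (hH : H.IsPolarizable) (γ : H.mumfordTateGroup) :
    γ ∈ Subgroup.center H.mumfordTateGroup ↔ ((γ : V ≃ₗ[ℚ] V) : Module.End ℚ V) ∈ H.endAlg := by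
  rw [Subgroup.mem_center_iff]
  constructor
  · intro h
    rw [← centralizer_centralizer_endAlg_eq' H hH, ← adjoin_hodgeGroup_eq_centralizer_endAlg H hH,
      centralizer_coe_adjoin_eq₅₄'', Subalgebra.mem_centralizer_iff]
    rintro _ ⟨g, hg, rfl⟩
    have hgγ := congrArg (fun ε : H.mumfordTateGroup => ((ε : V ≃ₗ[ℚ] V) : Module.End ℚ V))
      (h ⟨g, hodgeGroup_le_mumfordTateGroup H hg⟩)
    simpa only [Subgroup.coe_mul, LinearEquiv.coe_toLinearMap_mul] using hgγ
  · intro h δ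
    refine Subtype.ext (LinearEquiv.toLinearMap_injective ?_)
    rw [Subgroup.coe_mul, Subgroup.coe_mul, LinearEquiv.coe_toLinearMap_mul, LinearEquiv.coe_toLinearMap_mul]
    exact ((Subalgebra.mem_centralizer_iff ℚ).1 (mumfordTateGroup_mem_centralizer_endAlg H δ.2) _ h).symm

/-- **`Z(MT(H)(ℚ)) = MT(H)(ℚ) ⊓ Aut(V, φ)`** (equality). [cite: GreenGriffithsKerr2012, Prop. (V.2) and proof (p. 152), §V.B (i)–(ii)]
[cite: Milne1999LefschetzClasses, §1 Remark 1.2 (p. 643)] -/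
theorem center_mumfordTateGroup_eq_autGroup_subgroupOf (hH : H.IsPolarizable) :
    Subgroup.center H.mumfordTateGroup = H.autGroup.subgroupOf H.mumfordTateGroup := by
  ext γ
  rw [mem_center_mumfordTateGroup_iff H hH, Subgroup.mem_subgroupOf, mem_autGroup_iff]

/-- **`Z(Hg(H)(ℚ)) ⊆ Z(MT(H)(ℚ))`**: a central element of the Hodge group is central in the Mumford–Tate group (both centres are
cut out by `E_φ`). [cite: GreenGriffithsKerr2012, Prop. (V.2) and proof (p. 152)] [cite: Deligne1982HodgeCycles, I §3 Prop. 3.4] -/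
theorem inclusion_mem_center_mumfordTateGroup (hH : H.IsPolarizable) {γ : H.hodgeGroup}
    (hγ : γ ∈ Subgroup.center H.hodgeGroup) :
    Subgroup.inclusion (hodgeGroup_le_mumfordTateGroup H) γ ∈ Subgroup.center H.mumfordTateGroup := by
  rw [mem_center_mumfordTateGroup_iff H hH]
  exact (mem_center_hodgeGroup_iff H hH γ).1 hγ

variable {H} in
/-- **`Z(Hg(H)(ℚ)) ⊆ Z(S(H)(ℚ))`**: a central element of the Hodge group is central in Milne's Lefschetz group `S(H)(ℚ) ⊇ Hg(H)(ℚ)`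
(«`L(A) ⊃ Hg(A)`», the tree's `hodgeGroup_le_lefschetzGroup`; both centres are the intersections with `E_φ`, g54-#4).
[cite: Milne1999LefschetzClasses, §4 p. 660 L27–L35 and §1 Remark 1.2] [cite: GreenGriffithsKerr2012, Prop. (V.2) and proof (p. 152)] -/
theorem Polarization.inclusion_mem_center_lefschetzGroup (ψ : Polarization H) {γ : H.hodgeGroup}
    (hγ : γ ∈ Subgroup.center H.hodgeGroup) :
    Subgroup.inclusion ψ.hodgeGroup_le_lefschetzGroup γ ∈ Subgroup.center ψ.lefschetzGroup := by
  rw [ψ.mem_center_lefschetzGroup_iff]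
  exact (mem_center_hodgeGroup_iff H ⟨ψ⟩ γ).1 hγ

/-! ## §2 `K`-points: `Z(Hg(H)(K)) = Hg(H)(K) ∩ (E_φ ⊗ K)`, `Z(MT(H)(K)) = MT(H)(K) ∩ (E_φ ⊗ K)` -/

section Points

variable (K : Type uK) [Field K] [Algebra ℚ K]

/-- **AN ELEMENT OF `Hg(H)(K)` IS CENTRAL IFF IT LIES IN `E_φ ⊗ K`**, for every field `K ⊇ ℚ` (polarizable `H`): `⟹` because
`K[Hg(H)(K)] = C(H)(K)` (the tree's `adjoin_coe_hodgeGroupBaseChange_eq_centralizer_endAlg_baseChange`) and `Z_K(C(H)(K)) = E_φ ⊗ K`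
(Remark 1.2 on `K`-points, g54-#2); `⟸` because `Hg(H)(K)` commutes with every `a_K` (the tree's
`endAlg.baseChange_comp_eq_comp_of_mem_hodgeGroupBaseChange`), hence with `K[a_K]`.
[cite: GreenGriffithsKerr2012, Prop. (V.2) and proof (p. 152)] [cite: Milne1999LefschetzClasses, §1 Remark 1.2, Remark 1.6 and §3 p. 653]
[cite: Deligne1982HodgeCycles, I §5 proof of Prop. 5.1] -/
theorem mem_center_hodgeGroupBaseChange_iff (hH : H.IsPolarizable) (γ : H.hodgeGroupBaseChange K) :
    γ ∈ Subgroup.center (H.hodgeGroupBaseChange K) ↔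
      ((γ : (K ⊗[ℚ] V) ≃ₗ[K] (K ⊗[ℚ] V)) : Module.End K (K ⊗[ℚ] V)) ∈
        Algebra.adjoin K (Set.range fun a : H.endAlg => (a : Module.End ℚ V).baseChange K) := by
  rw [Subgroup.mem_center_iff, ← centralizer_centralizer_endAlg_baseChange_eq_adjoin K H hH,
    ← adjoin_coe_hodgeGroupBaseChange_eq_centralizer_endAlg_baseChange K H hH, centralizer_coe_adjoin_eq₅₄'',
    Subalgebra.mem_centralizer_iff]
  constructor
  · rintro h _ ⟨δ, hδ, rfl⟩
    have hδγ := congrArg (fun ε : H.hodgeGroupBaseChange K => ((ε : (K ⊗[ℚ] V) ≃ₗ[K] (K ⊗[ℚ] V)) :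
      Module.End K (K ⊗[ℚ] V))) (h ⟨δ, hδ⟩)
    simpa only [Subgroup.coe_mul, LinearEquiv.coe_toLinearMap_mul] using hδγ
  · intro h δ
    refine Subtype.ext (LinearEquiv.toLinearMap_injective ?_)
    rw [Subgroup.coe_mul, Subgroup.coe_mul, LinearEquiv.coe_toLinearMap_mul, LinearEquiv.coe_toLinearMap_mul]
    exact h _ ⟨δ, δ.2, rfl⟩

/-- **AN ELEMENT OF `MT(H)(K)` IS CENTRAL IFF IT LIES IN `E_φ ⊗ K`** (polarizable `H`, any field `K ⊇ ℚ`): `⟹` through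
`Hg(H)(K) ≤ MT(H)(K)`; `⟸`: `MT(H)(K)` commutes with every `a_K` (the tree's `endAlg.baseChange_comp_eq_comp_of_mem_mumfordTateGroupBaseChange`),
hence with the algebra `K[a_K] = E_φ ⊗ K`. [cite: GreenGriffithsKerr2012, Prop. (V.2) and proof (p. 152)]
[cite: Milne1999LefschetzClasses, §1 Remark 1.2 and Remark 1.6] [cite: Deligne1982HodgeCycles, I §3 Prop. 3.4] -/
theorem mem_center_mumfordTateGroupBaseChange_iff (hH : H.IsPolarizable) (γ : H.mumfordTateGroupBaseChange K) :
    γ ∈ Subgroup.center (H.mumfordTateGroupBaseChange K) ↔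
      ((γ : (K ⊗[ℚ] V) ≃ₗ[K] (K ⊗[ℚ] V)) : Module.End K (K ⊗[ℚ] V)) ∈
        Algebra.adjoin K (Set.range fun a : H.endAlg => (a : Module.End ℚ V).baseChange K) := by
  rw [Subgroup.mem_center_iff]
  constructor
  · intro h
    rw [← centralizer_centralizer_endAlg_baseChange_eq_adjoin K H hH,
      ← adjoin_coe_hodgeGroupBaseChange_eq_centralizer_endAlg_baseChange K H hH, centralizer_coe_adjoin_eq₅₄'',
      Subalgebra.mem_centralizer_iff]
    rintro _ ⟨δ, hδ, rfl⟩
    have hδγ := congrArg (fun ε : H.mumfordTateGroupBaseChange K => ((ε : (K ⊗[ℚ] V) ≃ₗ[K] (K ⊗[ℚ] V)) :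
      Module.End K (K ⊗[ℚ] V))) (h ⟨δ, hodgeGroupBaseChange_le_mumfordTateGroupBaseChange K H hδ⟩)
    simpa only [Subgroup.coe_mul, LinearEquiv.coe_toLinearMap_mul] using hδγ
  · intro h δ
    refine Subtype.ext (LinearEquiv.toLinearMap_injective ?_)
    rw [Subgroup.coe_mul, Subgroup.coe_mul, LinearEquiv.coe_toLinearMap_mul, LinearEquiv.coe_toLinearMap_mul]
    -- `↑δ` commutes with every `a_K`, hence with `K[a_K] ∋ ↑γ`
    have hδ : ((δ : (K ⊗[ℚ] V) ≃ₗ[K] (K ⊗[ℚ] V)) : Module.End K (K ⊗[ℚ] V)) ∈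
        Subalgebra.centralizer K (Set.range fun a : H.endAlg => (a : Module.End ℚ V).baseChange K) := by
      rw [Subalgebra.mem_centralizer_iff]
      rintro _ ⟨a, rfl⟩
      exact endAlg.baseChange_comp_eq_comp_of_mem_mumfordTateGroupBaseChange K H δ.2 a
    rw [← centralizer_coe_adjoin_eq₅₄''] at hδ
    exact ((Subalgebra.mem_centralizer_iff K).1 hδ _ h).symm

end Points

end HodgeStructure

end Literature.AlgebraicGeometry.Motives
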